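/-
Copyright (c) 2026 the pub-hodgecm-mathlib formalisation cell (harness21).  Prover seat hodgecm-mathlib-K2E3-p12 (g3), Track B «K2-LIT» ∕ h413
(`stmt-HodgeConjecture-24833`), line `K2_E3_EllipticInputs`, unit U12-d, §L: `Ad(GL_N(𝒪))` PRESERVES EVERY ADDITIVE HAAR MEASURE OF `𝔤𝔩_N(F)`.  2026-09-04.
-/
import Summits.HodgeConjecture.HodgeConjecture.Theorems.K2E3GLnNilpotentFourierPointSupport    -- ★ p856457 (this seat): `isOpen_isCompact_matrixIntegerBox`; ★ `glInt`, `primePowBall` kits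
import Mathlib.MeasureTheory.Measure.Haar.Unique
import HarnessLib

/-!
# K2_E3 road (h413), §L — `Ad(k)_* μ𝔤 = μ𝔤` for `k ∈ GL_N(𝒪)` and every additive Haar measure `μ𝔤` on `𝔤𝔩_N(F)`

Cell `pub/hodgecm-mathlib` (D-0151), Track B, seat K2E3-p12 (g3), §L line lead (dealer K2E3-plan (g2), D20); self-deal (AdK) announced on the squad bus
2026-09-04T02:36Z.  `--supports stmt-HodgeConjecture-24833 --as helper`; THEOREMS ONLY (no definition ∕ instance ∕ notation ∕ named fact ∕ `sorry`); never imports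
`Cruxes/…/Lines`.  COUNT-NEUTRAL.

The five Lie-algebra cores of U12 ED. 7 §L ((L-A_GL) :281, (L-B_GL) :310, their `𝔲`-twins, (12-D) :402) integrate against an ARBITRARY additive Haar measure `μ𝔤`
of `𝔤𝔩_N(F)` and conjugate test functions by `GL_N(F)`; every Lie-side computation (the `K × F` chart of `μ_reg`, ★ p856734; the structure and regularity debts
(a)∕(b) of ★ p856788; the finite `Ad(K)`-average) uses that `X ↦ k X k⁻¹` preserves `μ𝔤` for `k ∈ K = GL_N(𝒪)`.  This file proves it by the LATTICE ARGUMENT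
[WeilBNT1967, Ch. I §2 Cor. 2 of Thm. 3 (the module of an automorphism is read off one compact neighbourhood), Ch. II §2]: `Ad(k)` is a bi-continuous additive
automorphism, so `Ad(k)_* μ𝔤` is again an additive Haar measure, hence `c • μ𝔤` (Mathlib `isAddLeftInvariant_eq_smul`); and `Ad(k)` maps the compact open
integer box `𝒪^{N×N}` onto itself (`conj_mem_matrixIntegerBox`), so `c = 1`.
* §1 `conj_mem_matrixIntegerBox`, `preimage_conj_matrixIntegerBox` — `k 𝒪^{N×N} k⁻¹ = 𝒪^{N×N}` for `k ∈ GL_N(𝒪)`.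
* §2 **`map_conj_eq_self_of_mem_glInt`** — `μ𝔤.map (X ↦ k X k⁻¹) = μ𝔤`; **`measurePreserving_conj_of_mem_glInt`**; **`integral_comp_conj_of_mem_glInt`** —
  `∫ f(k X k⁻¹) dμ𝔤 = ∫ f dμ𝔤` for every `f` (no measurability needed: `Ad(k)` is a measurable equivalence); `lintegral_comp_conj_of_mem_glInt`.
Scope: `k ∈ GL_N(𝒪)` only (all that §L needs); the extension to `g ∈ GL_N(F)` (module of `Ad(g)` is `|det Ad(g)|_F = 1`, via `G = N A K`) is not proved here.

References: [WeilBNT1967] A. Weil, *Basic Number Theory* (1967), Ch. I §2 (module of an automorphism), Ch. II §2 · [HarishChandra1999AdmissibleDistributions]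
Harish-Chandra (DeBacker–Sally), AMS ULECT 16 (1999), §3 p. 8 (invariant measures on `𝔤`).
-/

set_option autoImplicit false
set_option linter.dupNamespace false   -- `Summit.HodgeConjecture.HodgeConjecture.…` (D-0017 nested layout; lakefile exemption for Summits)

noncomputable section

open MeasureTheory Measure Filter Topology
open scoped MatrixGroups NNReal ENNReal
open Literature.NumberTheory.Automorphic Literature.NumberTheory.Automorphic.LocalFieldHaar
open Literature.NumberTheory.GaloisRepresentations Literature.NumberTheory.GaloisRepresentations.IsNonarchimedeanLocalField
open Summit.HodgeConjecture.HodgeConjecture.Cruxes.H413.K2E3GLnNilpotentFourierPointSupport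

namespace Summit.HodgeConjecture.HodgeConjecture.Cruxes.H413.K2E3GLnLieAdIntegralInvariant

variable {F : Type*} [Field F] [ValuativeRel F] [TopologicalSpace F] [IsNonarchimedeanLocalField F] {N : ℕ}

/-! ## §1  `Ad(GL_N(𝒪))` preserves the integer box `𝒪^{N×N}` -/

/-- `k X k⁻¹ ∈ 𝒪^{N×N}` for `X ∈ 𝒪^{N×N}` and `k ∈ GL_N(𝒪)` (entries of `k`, `k⁻¹` are integral). [cite: WeilBNT1967, Ch. II §2] -/
theorem conj_mem_matrixIntegerBox {k : GL (Fin N) F} (hk : k ∈ glInt N F) {X : Matrix (Fin N) (Fin N) F} (hX : ∀ i j, X i j ∈ primePowBall F 0) :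
    ∀ i j, ((k : Matrix (Fin N) (Fin N) F) * X * ((k⁻¹ : GL (Fin N) F) : Matrix (Fin N) (Fin N) F)) i j ∈ primePowBall F 0 := by
  obtain ⟨hk1, hk2⟩ := (mem_glInt_iff k).1 hk
  intro i j
  rw [LocalFieldHaar.mem_primePowBall_zero_iff]
  simp only [Matrix.mul_apply]
  exact sum_mem fun l _ => mul_mem (sum_mem fun m _ => mul_mem (hk1 i m) ((LocalFieldHaar.mem_primePowBall_zero_iff).1 (hX m l))) (hk2 l j)

/-- `Ad(k)⁻¹(𝒪^{N×N}) = 𝒪^{N×N}` for `k ∈ GL_N(𝒪)`. [cite: WeilBNT1967, Ch. II §2] -/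
theorem preimage_conj_matrixIntegerBox {k : GL (Fin N) F} (hk : k ∈ glInt N F) :
    (fun X : Matrix (Fin N) (Fin N) F => (k : Matrix (Fin N) (Fin N) F) * X * ((k⁻¹ : GL (Fin N) F) : Matrix (Fin N) (Fin N) F)) ⁻¹'
        {X : Matrix (Fin N) (Fin N) F | ∀ i j, X i j ∈ primePowBall F 0} =
      {X : Matrix (Fin N) (Fin N) F | ∀ i j, X i j ∈ primePowBall F 0} := by
  ext X
  simp only [Set.mem_preimage, Set.mem_setOf_eq]
  refine ⟨fun h => ?_, fun h => conj_mem_matrixIntegerBox hk h⟩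
  have h' := conj_mem_matrixIntegerBox (Subgroup.inv_mem _ hk) h
  have hkk : ((k⁻¹ : GL (Fin N) F) : Matrix (Fin N) (Fin N) F) * (k : Matrix (Fin N) (Fin N) F) = 1 := by
    rw [← Units.val_mul, inv_mul_cancel, Units.val_one]
  have heq : ((k⁻¹ : GL (Fin N) F) : Matrix (Fin N) (Fin N) F) *
      ((k : Matrix (Fin N) (Fin N) F) * X * ((k⁻¹ : GL (Fin N) F) : Matrix (Fin N) (Fin N) F)) * (((k⁻¹)⁻¹ : GL (Fin N) F) : Matrix (Fin N) (Fin N) F) = X := by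
    simp only [inv_inv, Matrix.mul_assoc, hkk, Matrix.mul_one]
    rw [← Matrix.mul_assoc, hkk, Matrix.one_mul]
  rw [heq] at h'
  exact h'

/-! ## §2  `Ad(k)_* μ𝔤 = μ𝔤` -/

variable [MeasurableSpace (Matrix (Fin N) (Fin N) F)] [BorelSpace (Matrix (Fin N) (Fin N) F)]
  (μ𝔤 : Measure (Matrix (Fin N) (Fin N) F)) [μ𝔤.IsAddHaarMeasure]

omit [MeasurableSpace (Matrix (Fin N) (Fin N) F)] [BorelSpace (Matrix (Fin N) (Fin N) F)] in
/-- `X ↦ g X g⁻¹` is continuous on `𝔤𝔩_N(F)`. [folklore] -/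
theorem continuous_conj (g : GL (Fin N) F) :
    Continuous fun X : Matrix (Fin N) (Fin N) F => (g : Matrix (Fin N) (Fin N) F) * X * ((g⁻¹ : GL (Fin N) F) : Matrix (Fin N) (Fin N) F) :=
  (continuous_const.matrix_mul continuous_id).matrix_mul continuous_const

/-- **`Ad(k)` preserves every additive Haar measure of `𝔤𝔩_N(F)`** for `k ∈ GL_N(𝒪)`: `μ𝔤.map (X ↦ k X k⁻¹) = μ𝔤` (lattice argument: `Ad(k)_* μ𝔤 = c • μ𝔤` by
uniqueness, and both give the compact open box `𝒪^{N×N} = Ad(k)⁻¹ 𝒪^{N×N}` the same positive finite mass). [cite: WeilBNT1967, Ch. I §2, Cor. 2 of Thm. 3; Ch. II §2] -/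
theorem map_conj_eq_self_of_mem_glInt {k : GL (Fin N) F} (hk : k ∈ glInt N F) :
    μ𝔤.map (fun X : Matrix (Fin N) (Fin N) F => (k : Matrix (Fin N) (Fin N) F) * X * ((k⁻¹ : GL (Fin N) F) : Matrix (Fin N) (Fin N) F)) = μ𝔤 := by
  haveI : T2Space F := (isLocalField F).toT2Space
  haveI : LocallyCompactSpace F := (isLocalField F).toLocallyCompactSpace
  haveI : SecondCountableTopology F := secondCountableTopology_localField F
  haveI : LocallyCompactSpace (Matrix (Fin N) (Fin N) F) := Pi.locallyCompactSpace_of_finite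
  haveI : SecondCountableTopology (Matrix (Fin N) (Fin N) F) := inferInstanceAs (SecondCountableTopology (Fin N → Fin N → F))
  have hkk : ((k⁻¹ : GL (Fin N) F) : Matrix (Fin N) (Fin N) F) * (k : Matrix (Fin N) (Fin N) F) = 1 := by
    rw [← Units.val_mul, inv_mul_cancel, Units.val_one]
  have hkk' : (k : Matrix (Fin N) (Fin N) F) * ((k⁻¹ : GL (Fin N) F) : Matrix (Fin N) (Fin N) F) = 1 := by
    rw [← Units.val_mul, mul_inv_cancel, Units.val_one]
  -- `Ad(k)` as a bi-continuous additive automorphism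
  let φ : Matrix (Fin N) (Fin N) F ≃+ Matrix (Fin N) (Fin N) F :=
    { toFun := fun X => (k : Matrix (Fin N) (Fin N) F) * X * ((k⁻¹ : GL (Fin N) F) : Matrix (Fin N) (Fin N) F)
      invFun := fun X => ((k⁻¹ : GL (Fin N) F) : Matrix (Fin N) (Fin N) F) * X * (k : Matrix (Fin N) (Fin N) F)
      left_inv := fun X => by
        simp only [← Matrix.mul_assoc, hkk, Matrix.one_mul]
        rw [Matrix.mul_assoc, hkk, Matrix.mul_one]
      right_inv := fun X => by
        simp only [← Matrix.mul_assoc, hkk', Matrix.one_mul]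
        rw [Matrix.mul_assoc, hkk', Matrix.mul_one]
      map_add' := fun X Y => by rw [Matrix.mul_add, Matrix.add_mul] }
  have hφ : (φ : Matrix (Fin N) (Fin N) F → Matrix (Fin N) (Fin N) F) =
      fun X => (k : Matrix (Fin N) (Fin N) F) * X * ((k⁻¹ : GL (Fin N) F) : Matrix (Fin N) (Fin N) F) := rfl
  have hφc : Continuous φ := continuous_conj k
  have hφsc : Continuous φ.symm := by
    have h := continuous_conj (F := F) k⁻¹
    simp only [inv_inv] at h
    exact h
  haveI : (μ𝔤.map φ).IsAddHaarMeasure := AddEquiv.isAddHaarMeasure_map μ𝔤 φ hφc hφsc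
  -- uniqueness: `Ad(k)_* μ𝔤 = c • μ𝔤`
  have huniq := isAddLeftInvariant_eq_smul (μ𝔤.map φ) μ𝔤
  set c : ℝ≥0 := addHaarScalarFactor (μ𝔤.map φ) μ𝔤 with hc_def
  -- evaluate on the integer box
  obtain ⟨hΛo, hΛc, hΛ0⟩ := isOpen_isCompact_matrixIntegerBox (F := F) (N := N)
  have hΛpos : μ𝔤 {X : Matrix (Fin N) (Fin N) F | ∀ i j, X i j ∈ primePowBall F 0} ≠ 0 := (hΛo.measure_pos μ𝔤 ⟨0, hΛ0⟩).ne'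
  have hΛfin : μ𝔤 {X : Matrix (Fin N) (Fin N) F | ∀ i j, X i j ∈ primePowBall F 0} ≠ ∞ := hΛc.measure_lt_top.ne
  have hval : (μ𝔤.map φ) {X : Matrix (Fin N) (Fin N) F | ∀ i j, X i j ∈ primePowBall F 0} =
      μ𝔤 {X : Matrix (Fin N) (Fin N) F | ∀ i j, X i j ∈ primePowBall F 0} := by
    rw [Measure.map_apply hφc.measurable hΛo.measurableSet, hφ, preimage_conj_matrixIntegerBox hk]
  rw [huniq, Measure.coe_nnreal_smul_apply] at hval
  have hc1 : (c : ℝ≥0∞) = 1 := (ENNReal.mul_left_inj hΛpos hΛfin).1 (by rw [one_mul]; exact hval)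
  rw [ENNReal.coe_eq_one] at hc1
  rw [← hφ, huniq, hc1, one_smul]

/-- `Ad(k)` is measure preserving on `(𝔤𝔩_N(F), μ𝔤)` for `k ∈ GL_N(𝒪)`. [cite: WeilBNT1967, Ch. I §2, Cor. 2 of Thm. 3] -/
theorem measurePreserving_conj_of_mem_glInt {k : GL (Fin N) F} (hk : k ∈ glInt N F) :
    MeasurePreserving (fun X : Matrix (Fin N) (Fin N) F => (k : Matrix (Fin N) (Fin N) F) * X * ((k⁻¹ : GL (Fin N) F) : Matrix (Fin N) (Fin N) F)) μ𝔤 μ𝔤 :=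
  ⟨(continuous_conj k).measurable, map_conj_eq_self_of_mem_glInt μ𝔤 hk⟩

/-- **Substitution `X ↦ k X k⁻¹` in `μ𝔤`-integrals**: `∫ f(k X k⁻¹) dμ𝔤 = ∫ f dμ𝔤` for `k ∈ GL_N(𝒪)` and EVERY `f` (the substitution is a homeomorphism, so no
measurability hypothesis is needed). [cite: WeilBNT1967, Ch. I §2, Cor. 2 of Thm. 3] [cite: HarishChandra1999AdmissibleDistributions, §3 p. 8] -/
theorem integral_comp_conj_of_mem_glInt {E : Type*} [NormedAddCommGroup E] [NormedSpace ℝ E] {k : GL (Fin N) F} (hk : k ∈ glInt N F) (f : Matrix (Fin N) (Fin N) F → E) :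
    ∫ X, f ((k : Matrix (Fin N) (Fin N) F) * X * ((k⁻¹ : GL (Fin N) F) : Matrix (Fin N) (Fin N) F)) ∂μ𝔤 = ∫ X, f X ∂μ𝔤 := by
  have hkk : ((k⁻¹ : GL (Fin N) F) : Matrix (Fin N) (Fin N) F) * (k : Matrix (Fin N) (Fin N) F) = 1 := by
    rw [← Units.val_mul, inv_mul_cancel, Units.val_one]
  have hkk' : (k : Matrix (Fin N) (Fin N) F) * ((k⁻¹ : GL (Fin N) F) : Matrix (Fin N) (Fin N) F) = 1 := by
    rw [← Units.val_mul, mul_inv_cancel, Units.val_one]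
  let ψ : Matrix (Fin N) (Fin N) F ≃ₜ Matrix (Fin N) (Fin N) F :=
    { toFun := fun X => (k : Matrix (Fin N) (Fin N) F) * X * ((k⁻¹ : GL (Fin N) F) : Matrix (Fin N) (Fin N) F)
      invFun := fun X => ((k⁻¹ : GL (Fin N) F) : Matrix (Fin N) (Fin N) F) * X * (k : Matrix (Fin N) (Fin N) F)
      left_inv := fun X => by
        simp only [← Matrix.mul_assoc, hkk, Matrix.one_mul]
        rw [Matrix.mul_assoc, hkk, Matrix.mul_one]
      right_inv := fun X => by
        simp only [← Matrix.mul_assoc, hkk', Matrix.one_mul]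
        rw [Matrix.mul_assoc, hkk', Matrix.mul_one]
      continuous_toFun := continuous_conj k
      continuous_invFun := by
        have h := continuous_conj (F := F) k⁻¹
        simp only [inv_inv] at h
        exact h }
  exact (measurePreserving_conj_of_mem_glInt μ𝔤 hk).integral_comp ψ.measurableEmbedding f

/-- The `lintegral` form: `∫⁻ f(k X k⁻¹) dμ𝔤 = ∫⁻ f dμ𝔤` for `k ∈ GL_N(𝒪)` and every `f`. [cite: WeilBNT1967, Ch. I §2, Cor. 2 of Thm. 3] -/
theorem lintegral_comp_conj_of_mem_glInt {k : GL (Fin N) F} (hk : k ∈ glInt N F) (f : Matrix (Fin N) (Fin N) F → ℝ≥0∞) :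
    ∫⁻ X, f ((k : Matrix (Fin N) (Fin N) F) * X * ((k⁻¹ : GL (Fin N) F) : Matrix (Fin N) (Fin N) F)) ∂μ𝔤 = ∫⁻ X, f X ∂μ𝔤 := by
  have hkk : ((k⁻¹ : GL (Fin N) F) : Matrix (Fin N) (Fin N) F) * (k : Matrix (Fin N) (Fin N) F) = 1 := by
    rw [← Units.val_mul, inv_mul_cancel, Units.val_one]
  have hkk' : (k : Matrix (Fin N) (Fin N) F) * ((k⁻¹ : GL (Fin N) F) : Matrix (Fin N) (Fin N) F) = 1 := by
    rw [← Units.val_mul, mul_inv_cancel, Units.val_one]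
  let ψ : Matrix (Fin N) (Fin N) F ≃ₜ Matrix (Fin N) (Fin N) F :=
    { toFun := fun X => (k : Matrix (Fin N) (Fin N) F) * X * ((k⁻¹ : GL (Fin N) F) : Matrix (Fin N) (Fin N) F)
      invFun := fun X => ((k⁻¹ : GL (Fin N) F) : Matrix (Fin N) (Fin N) F) * X * (k : Matrix (Fin N) (Fin N) F)
      left_inv := fun X => by
        simp only [← Matrix.mul_assoc, hkk, Matrix.one_mul]
        rw [Matrix.mul_assoc, hkk, Matrix.mul_one]
      right_inv := fun X => by
        simp only [← Matrix.mul_assoc, hkk', Matrix.one_mul]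
        rw [Matrix.mul_assoc, hkk', Matrix.mul_one]
      continuous_toFun := continuous_conj k
      continuous_invFun := by
        have h := continuous_conj (F := F) k⁻¹
        simp only [inv_inv] at h
        exact h }
  exact (measurePreserving_conj_of_mem_glInt μ𝔤 hk).lintegral_comp_emb ψ.measurableEmbedding f

end Summit.HodgeConjecture.HodgeConjecture.Cruxes.H413.K2E3GLnLieAdIntegralInvariant
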